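import Summits.Parity.GeneralizedHardyLittlewood.Theses.LiouvilleMAD

/-!
# Route LiouvilleMAD — the glue `DecorrelationToDilatedChowla` (stmt-Parity-13321)

`DecorrelationToDilatedChowla : CosetDecorrelation → FanDecorrelation → DilatedChowla`.

Proof (Duke–Friedlander–Iwaniec divisor switching with sharp weights, as an exact identity).
Write `box M = (M,2M]²`, `Q = ⌊√M⌋ + 1`, `J = [Q, 2Q)` (so `|J| = Q` and `Q² > M`).
1. *Coset splitting.* For a modulus `j ≥ 1` the pairs `(m,m') ∈ box M` with `m ≡ m' (mod j)` are
   the disjoint union over `k ∈ [-M, M]` of the "fans" `m - m' = k·j`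
   (`decorrelationToDilatedChowla_coset_eq_biUnion`); summing over `j ∈ J` and separating `k = 0`
   (the diagonal, counted `|J|` times) gives the exact identity
   `|J|·Σ_m f(m,m) + Σ_{0<|k|≤M} Σ_{j∈J} Σ_{m−m'=kj} f(m,m') = Σ_{j∈J} Σ_{m≡m' (j)} f(m,m')`
   (`decorrelationToDilatedChowla_divisor_switch`, the unfolded statement of the route's support
   item `DivisorSwitch`, for an arbitrary weight `f`).
2. *Empty fans.* On `box M` one has `|m − m'| < M < Q²`, so the fan `m − m' = k·j` is empty as
   soon as `j ≥ Q` and `|k| ≥ Q` (`decorrelationToDilatedChowla_fan_eq_zero`).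
3. *Bookkeeping.* With `f(m,m') = λ(mn+c)λ(m'n'+c)` the coset sums are the `T_j` of
   `CosetDecorrelation` and the fan sums (summed over `j ∈ J`) are the `R_k` of `FanDecorrelation`;
   hence `Q·|S| ≤ Q·C₁⁺M^{3/4+ϑ₁} + (2Q−1)·C₂⁺M^{3/4+ϑ₂}`, and dividing by `Q` and using
   `M^{3/4+ϑᵢ} ≤ M^{1−κ}` for `M ≥ 1`, `κ = 1/4 − max ϑ₁ ϑ₂ > 0`, gives
   `|S| ≤ (C₁⁺ + 2C₂⁺)·M^{1−κ}`; `M = 0` is the empty sum.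
-/

namespace Summit.Parity.GeneralizedHardyLittlewood.Theorems

open Summit.Parity.GeneralizedHardyLittlewood.Theses.LiouvilleMAD

/-- Coset splitting for one modulus `j ≥ 1`: the pairs `(m,m') ∈ (M,2M]²` with
`m ≡ m' (mod j)` are the union over `k ∈ [-M, M]` of the fans `m - m' = k·j`
(for such pairs `|m - m'| ≤ M`, so the quotient `k` lies in `[-M, M]`). -/
theorem decorrelationToDilatedChowla_coset_eq_biUnion (M : ℕ) {j : ℕ} (hj : 1 ≤ j) :
    (Finset.Ioc M (2 * M) ×ˢ Finset.Ioc M (2 * M)).filter (fun p : ℕ × ℕ => p.1 ≡ p.2 [MOD j]) =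
      (Finset.Icc (-(M : ℤ)) M).biUnion (fun k : ℤ =>
        (Finset.Ioc M (2 * M) ×ˢ Finset.Ioc M (2 * M)).filter
          (fun p : ℕ × ℕ => (p.1 : ℤ) - p.2 = k * (j : ℤ))) := by
  ext p
  simp only [Finset.mem_filter, Finset.mem_biUnion, Finset.mem_Icc, Finset.mem_product,
    Finset.mem_Ioc]
  constructor
  · rintro ⟨hp, hmod⟩
    obtain ⟨t, ht⟩ := Nat.modEq_iff_dvd.mp hmod
    have h1 : (M : ℤ) < p.1 := by exact_mod_cast hp.1.1
    have h2 : (p.1 : ℤ) ≤ 2 * M := by exact_mod_cast hp.1.2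
    have h3 : (M : ℤ) < p.2 := by exact_mod_cast hp.2.1
    have h4 : (p.2 : ℤ) ≤ 2 * M := by exact_mod_cast hp.2.2
    have habs : |t| ≤ M := by
      have h5 : |(p.2 : ℤ) - p.1| ≤ M := abs_sub_le_iff.mpr ⟨by linarith, by linarith⟩
      have h6 : |(p.2 : ℤ) - p.1| = j * |t| := by
        rw [ht, abs_mul, Nat.abs_cast]
      have h7 : |t| ≤ j * |t| := le_mul_of_one_le_left (abs_nonneg t) (by exact_mod_cast hj)
      linarith
    obtain ⟨h8, h9⟩ := abs_le.mp habs
    exact ⟨-t, ⟨by linarith, by linarith⟩, hp, by linear_combination -ht⟩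
  · rintro ⟨k, -, hp, hk⟩
    exact ⟨hp, Nat.modEq_iff_dvd.mpr ⟨-k, by linear_combination -hk⟩⟩

/-- Coset splitting as a sum identity: for `j ≥ 1` and any weight `g` on pairs,
`Σ_{(m,m') ∈ (M,2M]², m ≡ m' (j)} g = Σ_{k ∈ [-M,M]} Σ_{m - m' = k·j} g`. -/
theorem decorrelationToDilatedChowla_coset_sum (g : ℕ × ℕ → ℝ) (M : ℕ) {j : ℕ} (hj : 1 ≤ j) :
    ∑ p ∈ (Finset.Ioc M (2 * M) ×ˢ Finset.Ioc M (2 * M)).filter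
        (fun p : ℕ × ℕ => p.1 ≡ p.2 [MOD j]), g p =
      ∑ k ∈ Finset.Icc (-(M : ℤ)) M, ∑ p ∈ (Finset.Ioc M (2 * M) ×ˢ Finset.Ioc M (2 * M)).filter
        (fun p : ℕ × ℕ => (p.1 : ℤ) - p.2 = k * (j : ℤ)), g p := by
  rw [decorrelationToDilatedChowla_coset_eq_biUnion M hj, Finset.sum_biUnion]
  intro k _ k' _ hne
  simp only [Function.onFun]
  rw [Finset.disjoint_left]
  intro p hp hp'
  rw [Finset.mem_filter] at hp hp'
  have hj0 : (j : ℤ) ≠ 0 := by exact_mod_cast (by omega : j ≠ 0)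
  exact hne (mul_right_cancel₀ hj0 (hp.2.symm.trans hp'.2))

/-- The diagonal fan `k = 0`: `Σ_{(m,m') ∈ (M,2M]², m - m' = 0·j} f m m' = Σ_{m ∈ (M,2M]} f m m`. -/
theorem decorrelationToDilatedChowla_diag_sum (f : ℕ → ℕ → ℝ) (M j : ℕ) :
    ∑ p ∈ (Finset.Ioc M (2 * M) ×ˢ Finset.Ioc M (2 * M)).filter
        (fun p : ℕ × ℕ => (p.1 : ℤ) - p.2 = 0 * (j : ℤ)), f p.1 p.2 =
      ∑ m ∈ Finset.Ioc M (2 * M), f m m := by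
  rw [Finset.sum_filter, Finset.sum_product]
  refine Finset.sum_congr rfl fun m hm => ?_
  simp only [zero_mul, sub_eq_zero, Nat.cast_inj]
  rw [Finset.sum_ite_eq, if_pos hm]

/-- **DFI divisor switching** (exact elementary identity; this is the route's support item
`DivisorSwitch`, unfolded, for an arbitrary weight `f`): with `J = [Q, 2Q)` and pairs in `(M,2M]²`,
`|J|·Σ_m f(m,m) + Σ_{0<|k|≤M} Σ_{j∈J} Σ_{m−m'=kj} f(m,m') = Σ_{j∈J} Σ_{m≡m' (mod j)} f(m,m')`. -/
theorem decorrelationToDilatedChowla_divisor_switch (f : ℕ → ℕ → ℝ) (M Q : ℕ) :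
    ((Finset.Ico Q (2 * Q)).card : ℝ) * (∑ m ∈ Finset.Ioc M (2 * M), f m m) +
      (∑ k ∈ (Finset.Icc (-(M : ℤ)) M).erase 0, ∑ j ∈ Finset.Ico Q (2 * Q),
        ∑ p ∈ (Finset.Ioc M (2 * M) ×ˢ Finset.Ioc M (2 * M)).filter
          (fun p : ℕ × ℕ => (p.1 : ℤ) - p.2 = k * (j : ℤ)), f p.1 p.2) =
      ∑ j ∈ Finset.Ico Q (2 * Q), ∑ p ∈ (Finset.Ioc M (2 * M) ×ˢ Finset.Ioc M (2 * M)).filter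
        (fun p : ℕ × ℕ => p.1 ≡ p.2 [MOD j]), f p.1 p.2 := by
  have hJ : ∀ j ∈ Finset.Ico Q (2 * Q), 1 ≤ j := by
    intro j hj
    rw [Finset.mem_Ico] at hj
    omega
  have h1 : ∑ j ∈ Finset.Ico Q (2 * Q), ∑ p ∈ (Finset.Ioc M (2 * M) ×ˢ Finset.Ioc M (2 * M)).filter
        (fun p : ℕ × ℕ => p.1 ≡ p.2 [MOD j]), f p.1 p.2 =
      ∑ j ∈ Finset.Ico Q (2 * Q), ∑ k ∈ Finset.Icc (-(M : ℤ)) M,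
        ∑ p ∈ (Finset.Ioc M (2 * M) ×ˢ Finset.Ioc M (2 * M)).filter
          (fun p : ℕ × ℕ => (p.1 : ℤ) - p.2 = k * (j : ℤ)), f p.1 p.2 :=
    Finset.sum_congr rfl fun j hj =>
      decorrelationToDilatedChowla_coset_sum (fun p : ℕ × ℕ => f p.1 p.2) M (hJ j hj)
  have h0 : (0 : ℤ) ∈ Finset.Icc (-(M : ℤ)) M := by simp
  rw [h1, Finset.sum_comm (s := Finset.Ico Q (2 * Q)) (t := Finset.Icc (-(M : ℤ)) M),
    ← Finset.add_sum_erase _ _ h0]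
  congr 1
  rw [Finset.sum_congr rfl fun j _ => decorrelationToDilatedChowla_diag_sum f M j, Finset.sum_const,
    nsmul_eq_mul]

/-- Empty fans: on `(M,2M]²` one has `|m - m'| < M`, so if `M < Q²`, `Q ≤ j` and `Q ≤ |k|` the fan
`m - m' = k·j` is empty and any sum over it vanishes. -/
theorem decorrelationToDilatedChowla_fan_eq_zero (g : ℕ × ℕ → ℝ) {M Q j : ℕ} {k : ℤ}
    (hQ : M < Q * Q) (hj : Q ≤ j) (hk : (Q : ℤ) ≤ |k|) :
    ∑ p ∈ (Finset.Ioc M (2 * M) ×ˢ Finset.Ioc M (2 * M)).filter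
        (fun p : ℕ × ℕ => (p.1 : ℤ) - p.2 = k * (j : ℤ)), g p = 0 := by
  refine Finset.sum_eq_zero fun p hp => ?_
  exfalso
  simp only [Finset.mem_filter, Finset.mem_product, Finset.mem_Ioc] at hp
  obtain ⟨⟨⟨h1, h2⟩, h3, h4⟩, hd⟩ := hp
  have h1' : (M : ℤ) < p.1 := by exact_mod_cast h1
  have h2' : (p.1 : ℤ) ≤ 2 * M := by exact_mod_cast h2
  have h3' : (M : ℤ) < p.2 := by exact_mod_cast h3
  have h4' : (p.2 : ℤ) ≤ 2 * M := by exact_mod_cast h4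
  have hQ' : (M : ℤ) < (Q : ℤ) * Q := by exact_mod_cast hQ
  have h5 : |(p.1 : ℤ) - p.2| < (Q : ℤ) * Q := by
    rw [abs_lt]
    constructor <;> linarith
  have h6 : (Q : ℤ) * Q ≤ |k| * j :=
    mul_le_mul hk (by exact_mod_cast hj) (by positivity) (abs_nonneg k)
  rw [hd, abs_mul, Nat.abs_cast] at h5
  linarith

/-- The glue item `DecorrelationToDilatedChowla` of route LiouvilleMAD (stmt-Parity-13321):
`CosetDecorrelation → FanDecorrelation → DilatedChowla`, with `κ = 1/4 − max ϑ₁ ϑ₂` and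
`C = max C₁ 0 + 2·max C₂ 0`.  Divisor switching (`decorrelationToDilatedChowla_divisor_switch`)
at `Q = ⌊√M⌋ + 1` expresses `Q·S` as the coset sums minus the fan sums; the fans with `|k| ≥ Q`
are empty (`decorrelationToDilatedChowla_fan_eq_zero`), at most `2Q − 1` values of `k` remain,
and one divides by `Q`. -/
theorem decorrelationToDilatedChowla_proof :
    Summit.Parity.GeneralizedHardyLittlewood.Theses.LiouvilleMAD.DecorrelationToDilatedChowla := by
  unfold Summit.Parity.GeneralizedHardyLittlewood.Theses.LiouvilleMAD.DecorrelationToDilatedChowla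
    CosetDecorrelation FanDecorrelation DilatedChowla
  intro h₁ h₂ c hc
  obtain ⟨ϑ₁, hϑ₁, C₁, hC₁⟩ := h₁ c hc
  obtain ⟨ϑ₂, hϑ₂, C₂, hC₂⟩ := h₂ c hc
  refine ⟨1 / 4 - max ϑ₁ ϑ₂, by have := max_lt hϑ₁ hϑ₂; linarith, max C₁ 0 + 2 * max C₂ 0, ?_⟩
  intro M n n' hn hn' hnn' hnM hn'M
  -- the weight and the three kinds of sums
  set f : ℕ → ℕ → ℝ := fun m m' =>
    (ArithmeticFunction.liouville (Int.toNat ((m : ℤ) * n + c)) : ℝ) *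
      (ArithmeticFunction.liouville (Int.toNat ((m' : ℤ) * n' + c)) : ℝ) with hf
  set Q : ℕ := Nat.sqrt M + 1 with hQdef
  set S : ℝ := ∑ m ∈ Finset.Ioc M (2 * M), f m m with hS
  set T : ℕ → ℝ := fun j => ∑ p ∈ (Finset.Ioc M (2 * M) ×ˢ Finset.Ioc M (2 * M)).filter
      (fun p : ℕ × ℕ => p.1 ≡ p.2 [MOD j]), f p.1 p.2 with hT
  set R : ℤ → ℝ := fun k => ∑ j ∈ Finset.Ico Q (2 * Q),
      ∑ p ∈ (Finset.Ioc M (2 * M) ×ˢ Finset.Ioc M (2 * M)).filter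
        (fun p : ℕ × ℕ => (p.1 : ℤ) - p.2 = k * (j : ℤ)), f p.1 p.2 with hR
  have hC₁0 : 0 ≤ max C₁ 0 := le_max_right _ _
  have hC₂0 : 0 ≤ max C₂ 0 := le_max_right _ _
  show |S| ≤ (max C₁ 0 + 2 * max C₂ 0) * (M : ℝ) ^ (1 - (1 / 4 - max ϑ₁ ϑ₂))
  rcases Nat.eq_zero_or_pos M with hM0 | hMpos
  · -- M = 0: the sum is empty
    subst hM0
    have hS0 : S = 0 := by simp [hS]
    rw [hS0, abs_zero]
    positivity
  -- M ≥ 1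
  have hM1 : (1 : ℝ) ≤ M := by exact_mod_cast hMpos
  have hQpos : (0 : ℝ) < Q := by positivity
  have hQ1 : 1 ≤ Q := by omega
  have hMQ : M < Q * Q := Nat.lt_succ_sqrt M
  have hcard : ((Finset.Ico Q (2 * Q)).card : ℝ) = Q := by
    rw [Nat.card_Ico, show 2 * Q - Q = Q by omega]
  -- divisor switching
  have hDS := decorrelationToDilatedChowla_divisor_switch f M Q
  rw [hcard] at hDS
  have hQS : (Q : ℝ) * S = ∑ j ∈ Finset.Ico Q (2 * Q), T j -
      ∑ k ∈ (Finset.Icc (-(M : ℤ)) M).erase 0, R k := by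
    rw [← hDS]
    ring
  -- coset bound
  have hTb : ∑ j ∈ Finset.Ico Q (2 * Q), |T j| ≤ (Q : ℝ) * (max C₁ 0 * (M : ℝ) ^ (3 / 4 + ϑ₁)) := by
    rw [← hcard, ← nsmul_eq_mul, ← Finset.sum_const]
    refine Finset.sum_le_sum fun j hj => ?_
    rw [Finset.mem_Ico] at hj
    calc |T j| ≤ C₁ * (M : ℝ) ^ (3 / 4 + ϑ₁) := hC₁ M n n' j hn hn' hnn' hnM hn'M hj.1 hj.2
      _ ≤ max C₁ 0 * (M : ℝ) ^ (3 / 4 + ϑ₁) :=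
          mul_le_mul_of_nonneg_right (le_max_left _ _) (by positivity)
  -- fan bound: only |k| < Q contributes
  have hRb : ∑ k ∈ (Finset.Icc (-(M : ℤ)) M).erase 0, |R k| ≤
      (2 * (Q : ℝ) - 1) * (max C₂ 0 * (M : ℝ) ^ (3 / 4 + ϑ₂)) := by
    set K := ((Finset.Icc (-(M : ℤ)) M).erase 0).filter (fun k : ℤ => |k| < Q) with hK
    have hsub : K ⊆ (Finset.Icc (-(M : ℤ)) M).erase 0 := Finset.filter_subset _ _
    have hzero : ∀ k ∈ (Finset.Icc (-(M : ℤ)) M).erase 0, k ∉ K → |R k| = 0 := by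
      intro k hk hkK
      have hkQ : (Q : ℤ) ≤ |k| := by
        by_contra h
        exact hkK (Finset.mem_filter.mpr ⟨hk, lt_of_not_ge h⟩)
      rw [abs_eq_zero]
      refine Finset.sum_eq_zero fun j hj => ?_
      rw [Finset.mem_Ico] at hj
      exact decorrelationToDilatedChowla_fan_eq_zero (fun p : ℕ × ℕ => f p.1 p.2) hMQ hj.1 hkQ
    rw [← Finset.sum_subset hsub hzero]
    have hKcard : (K.card : ℝ) ≤ 2 * (Q : ℝ) - 1 := by
      have hKsub : K ⊆ Finset.Ioo (-(Q : ℤ)) Q := by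
        intro k hk
        rw [hK, Finset.mem_filter] at hk
        rw [Finset.mem_Ioo]
        exact abs_lt.mp hk.2
      have h1 := Finset.card_le_card hKsub
      rw [Int.card_Ioo] at h1
      have h2 : K.card + 1 ≤ 2 * Q := by omega
      have h3 : (K.card : ℝ) + 1 ≤ 2 * Q := by exact_mod_cast h2
      linarith
    calc ∑ k ∈ K, |R k| ≤ ∑ k ∈ K, max C₂ 0 * (M : ℝ) ^ (3 / 4 + ϑ₂) := by
          refine Finset.sum_le_sum fun k hk => ?_
          have hk0 : k ≠ 0 := (Finset.mem_erase.mp (hsub hk)).1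
          calc |R k| ≤ C₂ * (M : ℝ) ^ (3 / 4 + ϑ₂) := hC₂ M n n' k hn hn' hnn' hnM hn'M hk0
            _ ≤ max C₂ 0 * (M : ℝ) ^ (3 / 4 + ϑ₂) :=
                mul_le_mul_of_nonneg_right (le_max_left _ _) (by positivity)
      _ = (K.card : ℝ) * (max C₂ 0 * (M : ℝ) ^ (3 / 4 + ϑ₂)) := by
          rw [Finset.sum_const, nsmul_eq_mul]
      _ ≤ (2 * (Q : ℝ) - 1) * (max C₂ 0 * (M : ℝ) ^ (3 / 4 + ϑ₂)) :=
          mul_le_mul_of_nonneg_right hKcard (by positivity)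
  -- exponents
  have he₁ : (M : ℝ) ^ (3 / 4 + ϑ₁) ≤ (M : ℝ) ^ (1 - (1 / 4 - max ϑ₁ ϑ₂)) :=
    Real.rpow_le_rpow_of_exponent_le hM1 (by have := le_max_left ϑ₁ ϑ₂; linarith)
  have he₂ : (M : ℝ) ^ (3 / 4 + ϑ₂) ≤ (M : ℝ) ^ (1 - (1 / 4 - max ϑ₁ ϑ₂)) :=
    Real.rpow_le_rpow_of_exponent_le hM1 (by have := le_max_right ϑ₁ ϑ₂; linarith)
  -- assemble: Q·|S| ≤ Q·C₁⁺M^{e₁} + (2Q−1)·C₂⁺M^{e₂}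
  have hQabs : (Q : ℝ) * |S| ≤ (Q : ℝ) * (max C₁ 0 * (M : ℝ) ^ (3 / 4 + ϑ₁)) +
      (2 * (Q : ℝ) - 1) * (max C₂ 0 * (M : ℝ) ^ (3 / 4 + ϑ₂)) := by
    have h1 : (Q : ℝ) * |S| = |(Q : ℝ) * S| := by
      rw [abs_mul, abs_of_pos hQpos]
    rw [h1, hQS]
    calc |∑ j ∈ Finset.Ico Q (2 * Q), T j - ∑ k ∈ (Finset.Icc (-(M : ℤ)) M).erase 0, R k|
        ≤ |∑ j ∈ Finset.Ico Q (2 * Q), T j| + |∑ k ∈ (Finset.Icc (-(M : ℤ)) M).erase 0, R k| :=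
          abs_sub _ _
      _ ≤ ∑ j ∈ Finset.Ico Q (2 * Q), |T j| + ∑ k ∈ (Finset.Icc (-(M : ℤ)) M).erase 0, |R k| :=
          add_le_add (Finset.abs_sum_le_sum_abs _ _) (Finset.abs_sum_le_sum_abs _ _)
      _ ≤ _ := add_le_add hTb hRb
  -- divide by Q and compare exponents
  have hmain : |S| ≤ max C₁ 0 * (M : ℝ) ^ (3 / 4 + ϑ₁) + 2 * (max C₂ 0 * (M : ℝ) ^ (3 / 4 + ϑ₂)) := by
    have h2 : (Q : ℝ) * |S| ≤ (Q : ℝ) * (max C₁ 0 * (M : ℝ) ^ (3 / 4 + ϑ₁) +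
        2 * (max C₂ 0 * (M : ℝ) ^ (3 / 4 + ϑ₂))) := by
      have h3 : 0 ≤ max C₂ 0 * (M : ℝ) ^ (3 / 4 + ϑ₂) := by positivity
      nlinarith
    exact le_of_mul_le_mul_left h2 hQpos
  calc |S| ≤ max C₁ 0 * (M : ℝ) ^ (3 / 4 + ϑ₁) + 2 * (max C₂ 0 * (M : ℝ) ^ (3 / 4 + ϑ₂)) := hmain
    _ ≤ max C₁ 0 * (M : ℝ) ^ (1 - (1 / 4 - max ϑ₁ ϑ₂)) +
        2 * (max C₂ 0 * (M : ℝ) ^ (1 - (1 / 4 - max ϑ₁ ϑ₂))) := by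
        gcongr
    _ = (max C₁ 0 + 2 * max C₂ 0) * (M : ℝ) ^ (1 - (1 / 4 - max ϑ₁ ϑ₂)) := by ring

end Summit.Parity.GeneralizedHardyLittlewood.Theorems
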